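import Summits.CriticalPhenomena.SAWScalingLimit.Theorems.LeftRightFKG.Negative.BoxCensus
import Summits.CriticalPhenomena.SAWScalingLimit.Theorems.LeftRightFKG.Negative.PolyCert
import HarnessLib

/-!
# Negative knowledge on crux `LeftRightFKG`, part 14: `PAKit` — a kernel checker for FULL left–right positive
association of one crux instance (definitions)

Crux `stmt-CriticalPhenomena-11232` (`Summit.CriticalPhenomena.SAWScalingLimit.Theses.SAWLeftRightFKG.LeftRightFKG`),
certified-compute lane, gen 2.  Parts 8–12 certified single corner MINORS of box instances; this kit certifies the
WHOLE conclusion of the crux for one instance `(dom C 1, a, b)` — `w(A) w(B) ≤ w(univ) w(A ∩ B)` for ALL `≼`-up-closed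
`A`, `B` — by establishing the corner-block hypothesis `hC` of `CornerLoc.pa_inst_of_cornerBlock` (part 13) from an
exact enumeration of the chords.  This file holds the COMPUTABLE side and its arithmetic soundness (the rest:
parts 15–17; instances: 18+):

* §1 exact integer polynomial arithmetic on coefficient lists (`addZ`, `smulZ`, `mulZ`, `minorZ`) and the minor
  test `minorOK S dp lo hi a d b c` = "`b·c ≤ a·d` on `[lo, hi]`": either the minor polynomial `a d − b c` is
  identically zero, or `PolyMP.posOn` (validated dyadic interval arithmetic, part `IntervalPolynomial`) certifies
  `a d − b c > 0` on the window;
* §2 codes of chords (`Code = List (ℤ × ℤ)`, the `toZ2`-image of the support): saturated vertex access from the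
  front (`getV`) and from the back (`getVR`), exact crossing counts `wcZ` of the upward probes of the faces of a
  box (mirror of `wcross`), and the decidable left–right test `lrCode` (dominance of all face crossing counts,
  which characterises `≼` on a box by part 6 `OrderCharacterisation`);
* §3 the checker `checkAll g L`: a trie over the prefix classes (codes agreeing at positions `1..k`) and, inside
  each, a trie over the suffix classes (agreeing at back positions `1..m`); for every class with `≥ 2` codes,
  `classOK` finds LINKED linear orders of the realised next steps and previous steps (consecutive directions
  realised by an `lrCode`-comparable pair — this is what makes every relative up-set an upper interval) and checks
  that the matrix of census polynomials `entry` (class × next step × previous step) is `TP₂` on the window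
  (`tp2OK` over all `2 × 2` minors via `minorOK`).  `codes inV N az bz` is the certified chord-code enumeration of
  `BoxCensus`.  A `Cfg` record carries the instance and window parameters;
* §4 soundness of the arithmetic: `minorOK_sound` — an accepted minor test gives `b(x) c(x) ≤ a(x) d(x)` for every
  real `x` of the window (`realOf_addZ/smulZ/mulZ`, `evalR_minorZ`, `PolyMP.posOn_sound`).

All functions are structurally recursive / `List` combinators and evaluate by `decide` / `native_decide`. Elementary
("folklore").
-/

namespace Summit.CriticalPhenomena.SAWScalingLimit.Theorems.LeftRightFKG.Negative.PAKit

open Literature.Analysis.ValidatedNumerics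
open PolyMP (evalR addR mulR smulR posOn)
open PolyCert (realOf minorI)
open Census (censusList census)

/-! ## §1 Exact integer polynomial arithmetic (mirror of `PolyMP.addR/smulR/mulR`) and the minor test -/

/-- Coefficientwise sum. [folklore] -/
def addZ : List ℤ → List ℤ → List ℤ
  | [], bs => bs
  | a :: as, [] => a :: as
  | a :: as, b :: bs => (a + b) :: addZ as bs

/-- Scalar multiple. [folklore] -/
def smulZ (c : ℤ) (as : List ℤ) : List ℤ := as.map (c * ·)

/-- Product. [folklore] -/
def mulZ : List ℤ → List ℤ → List ℤ
  | [], _ => []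
  | a :: as, bs => addZ (smulZ a bs) (0 :: mulZ as bs)

/-- All coefficients vanish. [folklore] -/
def isZeroZ (cs : List ℤ) : Bool := cs.all (· == 0)

/-- The minor `a·d − b·c` as an integer coefficient list. [folklore] -/
def minorZ (a d b c : List ℤ) : List ℤ := addZ (mulZ a d) (smulZ (-1) (mulZ b c))

/-- THE MINOR TEST on the window `[lo, hi]`: `b·c ≤ a·d` there, either because the minor vanishes identically
(exact integer arithmetic) or because the tree's validated-numerics sign checker proves it positive. [folklore] -/
def minorOK (S dp : ℕ) (lo hi : ℚ) (a d b c : List ℤ) : Bool :=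
  isZeroZ (minorZ a d b c) || posOn S dp (minorI S a d b c) lo hi

/-! ## §2 Codes of chords: saturated vertex access, crossing counts, the left–right test -/

/-- A chord code: the list of its sites as integer pairs. [folklore] -/
abbrev Code := List (ℤ × ℤ)

/-- Site `i` of a code, saturating at `bz` (the code of `b`) beyond the end — mirrors `Walk.getVert`. [folklore] -/
def getV (bz : ℤ × ℤ) (c : Code) (i : ℕ) : ℤ × ℤ := c.getD i bz

/-- Site `j` from the END of a code (mirrors `Walk.reverse.getVert`). [folklore] -/
def getVR (bz : ℤ × ℤ) (c : Code) (j : ℕ) : ℤ × ℤ := c.getD (c.length - 1 - j) bz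

/-- Signed crossing of the dart `p → q` over the probe of face `(m, k)` (mirror of `edgeCross`). [folklore] -/
def ecZ (m k : ℤ) (p q : ℤ × ℤ) : ℤ :=
  if p.1 = m ∧ q.1 = m + 1 ∧ q.2 = p.2 ∧ k + 1 ≤ p.2 then 1
  else if q.1 = m ∧ p.1 = m + 1 ∧ q.2 = p.2 ∧ k + 1 ≤ p.2 then -1 else 0

/-- Signed crossing count of a vertex chain (mirror of `pathCross`). [folklore] -/
def pcZ (m k : ℤ) : ℤ × ℤ → Code → ℤ
  | _, [] => 0
  | p, q :: l => ecZ m k p q + pcZ m k q l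

/-- Signed crossing count of a code over the probe of face `(m, k)` (mirror of `wcross`). [folklore] -/
def wcZ (m k : ℤ) : Code → ℤ
  | [] => 0
  | p :: l => pcZ m k p l

/-- The faces `(m, k)`, `X0 ≤ m < X1`, `Y0 ≤ k < Y1`, of the vertex box. [folklore] -/
def faces (X0 X1 Y0 Y1 : ℤ) : List (ℤ × ℤ) :=
  ((List.range (X1 - X0).toNat).map fun i : ℕ => X0 + i) ×ˢ ((List.range (Y1 - Y0).toNat).map fun j : ℕ => Y0 + j)

/-- THE LEFT–RIGHT TEST on codes: facewise dominance of crossing counts (`Negative.wind_nonneg_iff_wcross`).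
[folklore] -/
def lrCode (X0 X1 Y0 Y1 : ℤ) (c₁ c₂ : Code) : Bool :=
  (faces X0 X1 Y0 Y1).all fun f => decide (wcZ f.1 f.2 c₁ ≤ wcZ f.1 f.2 c₂)

/-! ## §3 The class trie, the per-class check, the whole checker -/

/-- Agreement of `c` with `ce` at positions `k+1, …, k'` of the accessor `pos`. [folklore] -/
def agreeOn (pos : Code → ℕ → ℤ × ℤ) (ce c : Code) (k k' : ℕ) : Bool :=
  (List.range (k' - k)).all fun t => decide (pos c (k + 1 + t) = pos ce (k + 1 + t))

/-- THE CLASS TRIE: `P` is a set of codes already agreeing up to position `k`; unless it is trivial (`≤ 1` code),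
run `act P k` and descend into the sub-classes by the value at position `k + 1` (fuel `f`). [folklore] -/
def trie (pos : Code → ℕ → ℤ × ℤ) (act : List Code → ℕ → Bool) : ℕ → List Code → ℕ → Bool
  | 0, _, _ => true
  | f + 1, P, k => decide (P.length ≤ 1) ||
      (act P k && ((P.map fun c => pos c (k + 1)).dedup.all fun u =>
        trie pos act f (P.filter fun c => decide (pos c (k + 1) = u)) (k + 1)))

/-- Consecutive directions of the list are LINKED inside `Q`: realised by a comparable pair of codes. [folklore] -/
def linkedB (lrC : Code → Code → Bool) (f : Code → ℤ × ℤ) (Q : List Code) : List (ℤ × ℤ) → Bool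
  | u :: v :: rest => (Q.any fun c => decide (f c = u) && Q.any fun c' => decide (f c' = v) && lrC c c')
      && linkedB lrC f Q (v :: rest)
  | _ => true

/-- Search for a linked linear order of the realised directions `f '' Q`. [folklore] -/
def findOrder (lrC : Code → Code → Bool) (f : Code → ℤ × ℤ) (Q : List Code) : Option (List (ℤ × ℤ)) :=
  ((Q.map f).dedup.permutations).find? (linkedB lrC f Q)

/-- Entry `(u, w)` of the end-step matrix of the class `Q`: the census (partition list) of the codes with next
direction `u` and previous direction `w`. [folklore] -/
def entry (fN fW : Code → ℤ × ℤ) (Q : List Code) (N : ℕ) (u w : ℤ × ℤ) : List ℤ :=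
  censusList (Q.filter fun c => decide (fN c = u) && decide (fW c = w)) N

/-- All `2 × 2` minors of the `p × q` matrix `M` pass the minor test `mOK a d b c` (`b·c ≤ a·d`). [folklore] -/
def tp2OK (mOK : List ℤ → List ℤ → List ℤ → List ℤ → Bool) (M : ℕ → ℕ → List ℤ) (p q : ℕ) : Bool :=
  (List.range p).all fun i' => (List.range i').all fun i =>
    (List.range q).all fun j' => (List.range j').all fun j => mOK (M i' j') (M i j) (M i' j) (M i j')

/-- Instance parameters of the checker: code of `b`, vertex box, length bound, numerics scale/depth, window.
[folklore] -/
structure Cfg where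
  /-- code of the endpoint `b` -/
  bz : ℤ × ℤ
  /-- vertex box `[X0, X1] × [Y0, Y1]` -/
  X0 : ℤ
  /-- vertex box -/
  X1 : ℤ
  /-- vertex box -/
  Y0 : ℤ
  /-- vertex box -/
  Y1 : ℤ
  /-- length bound of chords -/
  N : ℕ
  /-- fixed-point scale of the sign checker -/
  S : ℕ
  /-- bisection depth of the sign checker -/
  dp : ℕ
  /-- window, lower end -/
  lo : ℚ
  /-- window, upper end -/
  hi : ℚ

/-- THE PER-CLASS CHECK of the class `Q` with free positions after `k` (front) and `m` (back): find linked orders of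
the next and previous directions and certify all `2 × 2` minors of the end-step matrix on the window. [folklore] -/
def classOK (g : Cfg) (Q : List Code) (k m : ℕ) : Bool :=
  match findOrder (lrCode g.X0 g.X1 g.Y0 g.Y1) (fun c => getV g.bz c (k + 1)) Q,
    findOrder (lrCode g.X0 g.X1 g.Y0 g.Y1) (fun c => getVR g.bz c (m + 1)) Q with
  | some No, some Wo =>
    tp2OK (minorOK g.S g.dp g.lo g.hi)
      (fun i j => entry (fun c => getV g.bz c (k + 1)) (fun c => getVR g.bz c (m + 1)) Q g.N
        (No.getD i g.bz) (Wo.getD j g.bz))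
      No.length Wo.length
  | _, _ => false

/-- THE CHECKER: every non-trivial prefix/suffix class of the code list `L` passes `classOK`. [folklore] -/
def checkAll (g : Cfg) (L : List Code) : Bool :=
  trie (getV g.bz) (fun P k => trie (getVR g.bz) (fun Q m => classOK g Q k m) (g.N + 1) P 0) (g.N + 1) L 0

open Summit.CriticalPhenomena.SAWScalingLimit.Theorems.BoundaryTP2.Negative (pathsFrom endsAt) in
open Census (eqZ2 nbV) in
/-- The certified enumeration of chord codes of the box `inV` from `az` to `bz` with length bound `N`
(`Census.code_mem_enum` / `exists_chord_of_mem_enum`). [folklore] -/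
def codes (inV : ℤ × ℤ → Bool) (N : ℕ) (az bz : ℤ × ℤ) : List Code :=
  (pathsFrom eqZ2 (nbV inV) N az []).filter (endsAt eqZ2 bz)

/-! ## §4 Soundness of the arithmetic -/

/-- `realOf_addZ` (auxiliary). [folklore] -/
theorem realOf_addZ : ∀ as bs : List ℤ, realOf (addZ as bs) = addR (realOf as) (realOf bs)
  | [], bs => by simp [addZ, addR, realOf]
  | a :: as, [] => by simp [addZ, addR, realOf]
  | a :: as, b :: bs => by
    rw [addZ, PolyCert.realOf_cons, PolyCert.realOf_cons, PolyCert.realOf_cons, addR, realOf_addZ as bs,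
      Int.cast_add]

/-- `realOf_smulZ` (auxiliary). [folklore] -/
theorem realOf_smulZ (c : ℤ) (as : List ℤ) : realOf (smulZ c as) = smulR (c : ℝ) (realOf as) := by
  induction as with
  | nil => rfl
  | cons a as ih =>
    have e : smulZ c (a :: as) = (c * a) :: smulZ c as := rfl
    have e' : ∀ (r : ℝ) (l : List ℝ), smulR (c : ℝ) (r :: l) = ((c : ℝ) * r) :: smulR (c : ℝ) l := fun _ _ => rfl
    rw [e, PolyCert.realOf_cons, PolyCert.realOf_cons, e', ih, Int.cast_mul]

/-- `realOf_mulZ` (auxiliary). [folklore] -/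
theorem realOf_mulZ : ∀ as bs : List ℤ, realOf (mulZ as bs) = mulR (realOf as) (realOf bs)
  | [], bs => by simp [mulZ, mulR, realOf]
  | a :: as, bs => by
    rw [mulZ, realOf_addZ, realOf_smulZ, PolyCert.realOf_cons, realOf_mulZ as bs, PolyCert.realOf_cons, mulR,
      Int.cast_zero]

/-- A vanishing list evaluates to `0`. [folklore] -/
theorem evalR_of_isZeroZ {cs : List ℤ} (h : isZeroZ cs = true) (x : ℝ) : evalR (realOf cs) x = 0 := by
  induction cs with
  | nil => simp [realOf]
  | cons c cs ih =>
    simp only [isZeroZ, List.all_cons, Bool.and_eq_true, beq_iff_eq] at h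
    rw [PolyCert.realOf_cons, PolyMP.evalR_cons, ih h.2, h.1]
    simp

/-- The minor list evaluates to `a·d − b·c`. [folklore] -/
theorem evalR_minorZ (a d b c : List ℤ) (x : ℝ) : evalR (realOf (minorZ a d b c)) x =
    evalR (realOf a) x * evalR (realOf d) x - evalR (realOf b) x * evalR (realOf c) x := by
  rw [minorZ, realOf_addZ, realOf_mulZ, realOf_smulZ, realOf_mulZ, PolyMP.evalR_addR, PolyMP.evalR_mulR,
    PolyMP.evalR_smulR, PolyMP.evalR_mulR]
  push_cast
  ring

/-- **Soundness of the minor test**: `b(x)·c(x) ≤ a(x)·d(x)` on the window. [folklore] -/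
theorem minorOK_sound {S dp : ℕ} {lo hi : ℚ} {a d b c : List ℤ} (hS : 0 < S)
    (h : minorOK S dp lo hi a d b c = true) (hle : lo ≤ hi) {x : ℝ} (hlo : (lo : ℝ) ≤ x) (hhi : x ≤ (hi : ℝ)) :
    evalR (realOf b) x * evalR (realOf c) x ≤ evalR (realOf a) x * evalR (realOf d) x := by
  rw [minorOK, Bool.or_eq_true] at h
  rcases h with h | h
  · have e := evalR_minorZ a d b c x
    rw [evalR_of_isZeroZ h] at e
    linarith
  · exact (PolyCert.minor_pos_of_posOn hS h hle hlo hhi).le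

/-- Census lists have non-negative coefficients. [folklore] -/
theorem censusList_nonneg {α : Type*} (K : List (List α)) (N : ℕ) : ∀ c ∈ censusList K N, 0 ≤ c := by
  intro c hc
  simp only [censusList, List.mem_map, List.mem_range] at hc
  obtain ⟨i, -, rfl⟩ := hc
  exact Int.natCast_nonneg _

end Summit.CriticalPhenomena.SAWScalingLimit.Theorems.LeftRightFKG.Negative.PAKit
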